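import Summits.CriticalPhenomena.Ising3D.TaylorOddConeRegionCheck
import Literature.MathematicalPhysics.QuantumFieldTheory.ConformalBootstrap3D.PointKernelPowers
import Mathlib.Tactic.Linarith
import Mathlib.Tactic.Positivity
import Mathlib.Tactic.Ring
import HarnessLib

/-!
# Turnkey region certificates: the box inputs (`MI` enclosures of `Δσ, Δε, s̄, Δσ-Δε` and of the three
powers of `½`) from rational data, and the two REGION obligations for a rational box from ONE Boolean check
(cell `pub-ising3x`, seat recog-1 gen 11; gate (g2), kernel route)

HONEST FRAMING: lottery ticket; floor = tightest certified 3D Ising CFT bounds; no exact-solution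
claim without a proof.

`TaylorKernelRegionCheck` / `TaylorOddConeRegionCheck` take the box scalars as `MI` INPUTS with membership
hypotheses `∀ p ∈ Q`. Here they are PRODUCED from a rational box `[σlo, σhi] × [εlo, εhi]`: the affine ones by
`MI.span` of thin rationals (`enclQ`), the powers `(½)^{Δσ+Δε}`, `(½)^{Δε-Δσ}`, `(½)^{-2Δε} = 2^{2Δε}` from the
tree's exact ROOT ATOMS (`PointKernel.checkRoot` / `mem_of_checkRoot`: `R ∋ (p/q)^{a/d}` by one integer
comparison) at the two exponent end points and monotonicity of `b^x`. Results: `structure EvenRegionCert` /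
`OddConeRegionCert` (rational data + atoms + checker parameters) with `check : Bool` and
**`taylorEvenRegion_of_cert`**: `c.check = true → TaylorEvenRegion (taylorCrossing ½ ½ c.l.toFinset ↑c.cQ) c.box (c.P0 + c.ccQ)`,
**`oddCone_of_cert`**: `c.check = true → ∀ p ∈ c.box, ∀ E ≥ c.P0 + c.ccQ, ∀ j ≤ E, OddConeAt …` — i.e. the
`even_region` / `odd_cone` fields of `TaylorConeObligations` for the box, by `decide +kernel` on rational data.
SUFFICIENT only (kernel route). Elementary. [folklore]
-/

namespace Summit.CriticalPhenomena.Ising3D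

open Finset Set
open Literature.Analysis.ValidatedNumerics Literature.Analysis.ValidatedNumerics.PolyMP
open Literature.Analysis.ValidatedNumerics.NumericsMP (MI)
open Literature.MathematicalPhysics.QuantumFieldTheory.ConformalBootstrap3D
open PointKernel (checkRoot mem_of_checkRoot)

/-! ### Affine box scalars -/

/-- `MI` enclosure of the rational interval `[lo, hi]`. [folklore] -/
def enclQ (S : ℕ) (lo hi : ℚ) : MI := MI.span (PolyMP.ofRat S lo) (PolyMP.ofRat S hi)

/-- [folklore] -/
theorem mem_enclQ (S : ℕ) {lo hi : ℚ} {x : ℝ} (h1 : (lo : ℝ) ≤ x) (h2 : x ≤ hi) : MI.mem S x (enclQ S lo hi) :=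
  MI.mem_span (mem_ofRat S lo) (mem_ofRat S hi) h1 h2

/-! ### Root atoms for the powers of `½` -/

/-- A claimed enclosure `R ∋ b^{a/d}` (base fixed by the user of the atom). [folklore] -/
structure RootAtom where
  /-- exponent numerator -/
  a : ℕ
  /-- exponent denominator (`> 0`) -/
  d : ℕ
  /-- the interval -/
  R : MI
  deriving DecidableEq, Repr

/-- The atom is checked for base `p/q` and its exponent equals the rational `e`. [folklore] -/
def RootAtom.ok (S p q : ℕ) (t : RootAtom) (e : ℚ) : Bool :=
  decide (0 < t.d) && checkRoot S p q t.a t.d t.R && decide (((t.a : ℚ) / t.d) = e)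

/-- [folklore] -/
theorem RootAtom.mem_of_ok {S p q : ℕ} (hS : 0 < S) (hp : 0 < p) (hq : 0 < q) {t : RootAtom} {e : ℚ}
    (h : t.ok S p q e = true) : MI.mem S (((p : ℝ) / q) ^ (e : ℝ)) t.R := by
  simp only [RootAtom.ok, Bool.and_eq_true, decide_eq_true_eq] at h
  obtain ⟨⟨hd, hc⟩, he⟩ := h
  have hm := mem_of_checkRoot hS hp hq hd hc
  have : ((t.a : ℝ) / t.d) = (e : ℝ) := by rw [← he]; push_cast; ring
  rwa [this] at hm

/-- `(½)^x` on `x ∈ [elo, ehi]` from the atoms at the two ends (antitone). [folklore] -/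
theorem mem_half_rpow_span {S : ℕ} (hS : 0 < S) {tlo thi : RootAtom} {elo ehi : ℚ}
    (hlo : tlo.ok S 1 2 elo = true) (hhi : thi.ok S 1 2 ehi = true) {x : ℝ} (h1 : (elo : ℝ) ≤ x) (h2 : x ≤ ehi) :
    MI.mem S ((1 / 2 : ℝ) ^ x) (MI.span thi.R tlo.R) := by
  have m1 := RootAtom.mem_of_ok hS one_pos two_pos hlo
  have m2 := RootAtom.mem_of_ok hS one_pos two_pos hhi
  simp only [Nat.cast_one, Nat.cast_ofNat] at m1 m2
  refine MI.mem_span m2 m1 ?_ ?_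
  · exact Real.rpow_le_rpow_of_exponent_ge (by norm_num) (by norm_num) h2
  · exact Real.rpow_le_rpow_of_exponent_ge (by norm_num) (by norm_num) h1

/-- `(½)^{-y} = 2^{y}` on `y ∈ [elo, ehi]` from base-`2` atoms (monotone). [folklore] -/
theorem mem_half_rpow_neg_span {S : ℕ} (hS : 0 < S) {tlo thi : RootAtom} {elo ehi : ℚ}
    (hlo : tlo.ok S 2 1 elo = true) (hhi : thi.ok S 2 1 ehi = true) {y : ℝ} (h1 : (elo : ℝ) ≤ y) (h2 : y ≤ ehi) :
    MI.mem S ((1 / 2 : ℝ) ^ (-y)) (MI.span tlo.R thi.R) := by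
  have m1 := RootAtom.mem_of_ok hS two_pos one_pos hlo
  have m2 := RootAtom.mem_of_ok hS two_pos one_pos hhi
  simp only [Nat.cast_one, Nat.cast_ofNat, div_one] at m1 m2
  have e : (1 / 2 : ℝ) ^ (-y) = (2 : ℝ) ^ y := by
    rw [Real.rpow_neg (by norm_num), one_div, Real.inv_rpow (by norm_num), inv_inv]
  rw [e]
  refine MI.mem_span m1 m2 ?_ ?_
  · exact Real.rpow_le_rpow_of_exponent_le (by norm_num) h1
  · exact Real.rpow_le_rpow_of_exponent_le (by norm_num) h2

/-! ### The rational box -/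

/-- A rational box `[σlo, σhi] × [εlo, εhi]`. [folklore] -/
structure BoxQ where
  σlo : ℚ
  σhi : ℚ
  εlo : ℚ
  εhi : ℚ
  deriving DecidableEq, Repr

/-- The box as a set. [folklore] -/
def BoxQ.toSet (B : BoxQ) : Set (ℝ × ℝ) := Icc (B.σlo : ℝ) B.σhi ×ˢ Icc (B.εlo : ℝ) B.εhi

/-- [folklore] -/
theorem BoxQ.bounds {B : BoxQ} {p : ℝ × ℝ} (hp : p ∈ B.toSet) :
    (B.σlo : ℝ) ≤ p.1 ∧ p.1 ≤ B.σhi ∧ (B.εlo : ℝ) ≤ p.2 ∧ p.2 ≤ B.εhi := by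
  simp only [BoxQ.toSet, Set.mem_prod, Set.mem_Icc] at hp
  exact ⟨hp.1.1, hp.1.2, hp.2.1, hp.2.2⟩

/-! ### Turnkey even-region certificate -/

/-- Rational data of an even-region certificate for a box. [folklore] -/
structure EvenRegionCert where
  S : ℕ
  box : BoxQ
  l : List (ℕ × ℕ)
  cQ : Fin 5 → ℕ × ℕ → ℚ
  ccQ : ℚ
  P0 : ℚ
  N : ℕ
  prmX : HSParams
  prmY : HSParams
  prmD : HSParams

namespace EvenRegionCert

/-- The derived `EvenRegionData` (box scalars by `enclQ`). [folklore] -/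
def data (c : EvenRegionCert) : EvenRegionData where
  S := c.S
  l := c.l
  cQ := c.cQ
  sσI := enclQ c.S c.box.σlo c.box.σhi
  sεI := enclQ c.S c.box.εlo c.box.εhi
  sbI := enclQ c.S ((c.box.σlo + c.box.εlo) / 2) ((c.box.σhi + c.box.εhi) / 2)
  ccQ := c.ccQ
  P0 := c.P0
  N := c.N
  prmX := c.prmX
  prmY := c.prmY
  prmD := c.prmD

/-- **The check**: the index list is duplicate-free and the data check passes. [folklore] -/
def check (c : EvenRegionCert) : Bool := decide c.l.Nodup && c.data.check

end EvenRegionCert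

/-- **The even-sector region obligation for a rational box from one Boolean check.** [folklore] -/
theorem taylorEvenRegion_of_cert (c : EvenRegionCert) (h : c.check = true) :
    TaylorEvenRegion (taylorCrossing (1 / 2) (1 / 2) c.l.toFinset fun i ab => (c.cQ i ab : ℝ)) c.box.toSet
      ((c.P0 : ℝ) + c.ccQ) := by
  simp only [EvenRegionCert.check, Bool.and_eq_true, decide_eq_true_eq] at h
  obtain ⟨hl, hd⟩ := h
  refine taylorEvenRegion_of_evenRegionCheck c.data hl c.box.toSet (fun p hp => ?_) hd
  obtain ⟨h1, h2, h3, h4⟩ := BoxQ.bounds hp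
  refine ⟨mem_enclQ _ h1 h2, mem_enclQ _ h3 h4, mem_enclQ _ ?_ ?_⟩
  · push_cast; linarith
  · push_cast; linarith

/-! ### Turnkey odd-cone certificate -/

/-- Rational data of an odd-cone region certificate for a box (six root atoms for the powers of `½`).
[folklore] -/
structure OddConeRegionCert where
  S : ℕ
  box : BoxQ
  l : List (ℕ × ℕ)
  cQ : Fin 5 → ℕ × ℕ → ℚ
  lψ : List (ℕ × ℕ)
  ψQ : ℕ × ℕ → ℚ
  κ₀Q : ℚ
  /-- atoms `(½)^{σlo+εlo}`, `(½)^{σhi+εhi}` (for `κ₁`), `(½)^{εlo-σhi}`, `(½)^{εhi-σlo}` (for `κ₂`),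
  `2^{2εlo}`, `2^{2εhi}` (for `κ₃`) -/
  k1lo : RootAtom
  k1hi : RootAtom
  k2lo : RootAtom
  k2hi : RootAtom
  k3lo : RootAtom
  k3hi : RootAtom
  ccQ : ℚ
  P0 : ℚ
  N : ℕ
  prmM1 : HSParams
  prmM2 : HSParams
  prmR1 : HSParams
  prmR2 : HSParams

namespace OddConeRegionCert

/-- The derived `OddConeRegionData`. [folklore] -/
def data (c : OddConeRegionCert) : OddConeRegionData where
  S := c.S
  l := c.l
  cQ := c.cQ
  lψ := c.lψ
  ψQ := c.ψQ
  κ₀Q := c.κ₀Q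
  sσI := enclQ c.S c.box.σlo c.box.σhi
  sbI := enclQ c.S ((c.box.σlo + c.box.εlo) / 2) ((c.box.σhi + c.box.εhi) / 2)
  stI := enclQ c.S (c.box.σlo - c.box.εhi) (c.box.σhi - c.box.εlo)
  K1 := MI.span c.k1hi.R c.k1lo.R
  K2 := MI.span c.k2hi.R c.k2lo.R
  K3 := MI.span c.k3lo.R c.k3hi.R
  ccQ := c.ccQ
  P0 := c.P0
  N := c.N
  prmM1 := c.prmM1
  prmM2 := c.prmM2
  prmR1 := c.prmR1
  prmR2 := c.prmR2

/-- **The check**: index lists duplicate-free, the six atoms checked against the box's exponent end points,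
and the data check. [folklore] -/
def check (c : OddConeRegionCert) : Bool :=
  decide (0 < c.S) && decide c.l.Nodup && decide c.lψ.Nodup &&
  c.k1lo.ok c.S 1 2 (c.box.σlo + c.box.εlo) && c.k1hi.ok c.S 1 2 (c.box.σhi + c.box.εhi) &&
  c.k2lo.ok c.S 1 2 (c.box.εlo - c.box.σhi) && c.k2hi.ok c.S 1 2 (c.box.εhi - c.box.σlo) &&
  c.k3lo.ok c.S 2 1 (2 * c.box.εlo) && c.k3hi.ok c.S 2 1 (2 * c.box.εhi) &&
  c.data.check

end OddConeRegionCert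

/-- **The odd-cone region obligation for a rational box from one Boolean check.** [folklore] -/
theorem oddCone_of_cert (c : OddConeRegionCert) (h : c.check = true) :
    ∀ p ∈ c.box.toSet, ∀ (E : ℝ) (j : ℕ), (c.P0 : ℝ) + c.ccQ ≤ E → (j : ℝ) ≤ E →
      OddConeAt (taylorCrossing (1 / 2) (1 / 2) c.l.toFinset fun i ab => (c.cQ i ab : ℝ))
        (∑ ab ∈ c.lψ.toFinset, (c.ψQ ab : ℝ) • taylorCoeffAt (1 / 2) (1 / 2) ab) (c.κ₀Q : ℝ) p.1 p.2 E j := by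
  simp only [OddConeRegionCert.check, Bool.and_eq_true, decide_eq_true_eq] at h
  obtain ⟨⟨⟨⟨⟨⟨⟨⟨⟨hS, hl⟩, hlψ⟩, hk1lo⟩, hk1hi⟩, hk2lo⟩, hk2hi⟩, hk3lo⟩, hk3hi⟩, hd⟩ := h
  refine oddCone_of_oddConeRegionCheck c.data hl hlψ c.box.toSet (fun p hp => ?_) hd
  obtain ⟨h1, h2, h3, h4⟩ := BoxQ.bounds hp
  refine ⟨mem_enclQ _ h1 h2, mem_enclQ _ (by push_cast; linarith) (by push_cast; linarith),
    mem_enclQ _ (by push_cast; linarith) (by push_cast; linarith), ?_, ?_, ?_⟩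
  · exact mem_half_rpow_span hS hk1lo hk1hi (by push_cast; linarith) (by push_cast; linarith)
  · exact mem_half_rpow_span hS hk2lo hk2hi (by push_cast; linarith) (by push_cast; linarith)
  · exact mem_half_rpow_neg_span hS hk3lo hk3hi (y := 2 * p.2) (by push_cast; linarith) (by push_cast; linarith)

/-! ### The forms a `TaylorTable` instantiates: box as `Icc ×ˢ Icc`, thresholds as casts of one rational -/

/-- [folklore] -/
theorem taylorEvenRegion_of_cert_rat (c : EvenRegionCert) (h : c.check = true) :
    TaylorEvenRegion (taylorCrossing (1 / 2) (1 / 2) c.l.toFinset fun i ab => (c.cQ i ab : ℝ))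
      (Icc (c.box.σlo : ℝ) c.box.σhi ×ˢ Icc (c.box.εlo : ℝ) c.box.εhi) ((c.P0 + c.ccQ : ℚ) : ℝ) := by
  rw [Rat.cast_add]
  exact taylorEvenRegion_of_cert c h

/-- [folklore] -/
theorem oddCone_of_cert_rat (c : OddConeRegionCert) (h : c.check = true) :
    ∀ p ∈ Icc (c.box.σlo : ℝ) c.box.σhi ×ˢ Icc (c.box.εlo : ℝ) c.box.εhi, ∀ (E : ℝ) (j : ℕ),
      ((c.P0 + c.ccQ : ℚ) : ℝ) ≤ E → (j : ℝ) ≤ E →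
      OddConeAt (taylorCrossing (1 / 2) (1 / 2) c.l.toFinset fun i ab => (c.cQ i ab : ℝ))
        (∑ ab ∈ c.lψ.toFinset, (c.ψQ ab : ℝ) • taylorCoeffAt (1 / 2) (1 / 2) ab) (c.κ₀Q : ℝ) p.1 p.2 E j := by
  intro p hp E j hE hj
  rw [Rat.cast_add] at hE
  exact oddCone_of_cert c h p hp E j hE hj

end Summit.CriticalPhenomena.Ising3D
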